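import Summits.NavierStokesRegularity.NavierStokesRegularity.Theorems.TypeIQuantSubcubicExp.Negative.QuietCollarByName
import Summits.NavierStokesRegularity.NavierStokesRegularity.Theorems.QuarterLogPincerTruncationEdgeT1
import HarnessLib

/-!
# The `quiet_core` objects, typed — refuter side, negative lane: rest state, converse logic, wall placement

Crux `stmt-NavierStokesRegularity-24077` (`QuarterLogPincer.TypeIQuantSubcubicExp`), line
`Cruxes/TypeIQuantSubcubicExp/Lines/quiet_core.lean` v1.0 (ns-idea-7 g10, 2026-08-29; commit `1083e9a738b5`;
registered stubs S3♭ `stub_subcriticalUpgrade`, S4♭ `stub_budgetPass`, Q2♭ `stub_logCubeExtractionFlat`; QC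
`StubQuietCore` derived). The Cruxes workfile is not importable from `Theorems/`, so the findings are stated over
the BODIES of the line's new objects (`SubcriticalUpgrade`, `BudgetPass`, `QuietCore`, `CubeBudgetWith`,
`LocalRateFloorLogCube`, `StubLogCubeExtractionFlat`, `SmallBudgetLiouville`), verbatim or — where marked — with
the budget hypothesis DROPPED (a strengthening, so the line's object follows by weakening); the older objects are
used BY NAME from the landed `QuarterLogPincerQuietCollarDefs` / `…ThinCascadeDefs` / `…TruncationEdgeDefs`
(`LogCubeLiouville`, `LogCubeFloorLiouville`, `LocalRateFloor`, `SingularAt`, `EnvelopeCubeBudget`). Nothing here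
asserts 24077, 24453, 22144, 4050 or a stub of the line. No summit statement and no crux is proved by this file.

Findings.
* (F1) CONSISTENCY CEILING. Item stmt-4050 `TypeIAncientLiouville` ⇒ S3♭ (verbatim), S4♭ and QC (budget-free
  strengthenings), Q3♭ `LocalRateFloorLogCube` (verbatim, by name), and the rung `SmallBudgetLiouville M B₀` at
  EVERY level `B₀` (verbatim body): none of the line's `v`-quantified objects is refutable short of a nonzero
  Type-I ancient mild solution. The same conclusions hold UNCONDITIONALLY on the degenerate stratum `M ≤ 0`
  (the class is `{0}` there, `IsTypeIAncientMild.norm_le`).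
* (F1′) NON-VACUITY. The hypotheses of S3♭ / S4♭ / QC (class membership, the exposed budget `CubeBudgetWith 0`,
  a quiet unit core at every `s < 0`, the subcritical bound) are met by the rest state for every `M ≥ 0`, `c₀ ≥ 0`.
* (F2) Q2♭ IS THE CONVERSE EDGE WITH THE APEX VALUE: `StubLogCubeExtractionFlat ↔ (LogCubeLiouville → crux)`
  (pure logic); hence under item 4050 `StubLogCubeExtractionFlat ↔ TypeIQuantSubcubicExp` (Q2♭ carries the whole
  crux in the Liouville world), while `¬ LogCubeLiouville → StubLogCubeExtractionFlat` (Q2♭ holds outright in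
  the wall world).
* (F3) WALL PLACEMENT. Any Type-I (rotated-)DSS profile `IsTypeIDSSProfile c R u` (every ratio `c > 1`) gives
  `StubLogCubeExtractionFlat ∧ ¬ TypeIQuantSubcubicExp ∧ ¬ LogCubeLiouville`, so LOOP♭'s identification
  `TypeIQuantSubcubicExp ↔ LogCubeLiouville` holds there as `False ↔ False` with no stub; `¬ 22144` and `¬ 24453`
  likewise give `StubLogCubeExtractionFlat` (via the landed `not_logCube_values_of_…`).
-/

-- the summit and its single sub-problem share the name (CONVENTIONS §1), as in every Theorems file
set_option linter.dupNamespace false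

namespace Summit.NavierStokesRegularity.NavierStokesRegularity.Theorems.TypeIQuantSubcubicExp.Negative

open MeasureTheory Set Metric Function
open Literature.Analysis Literature.Analysis.FluidPDE
open Summit.NavierStokesRegularity.NavierStokesRegularity.Theses
open Summit.NavierStokesRegularity.NavierStokesRegularity.Cruxes.TypeIQuantSubcubicExp
open Summit.NavierStokesRegularity.NavierStokesRegularity.Cruxes.TypeIQuantSubcubicExp.ThinCascade (SingularAt)
open Summit.NavierStokesRegularity.NavierStokesRegularity.Cruxes.TypeIQuantSubcubicExp.TruncationEdge
  (EnvelopeCubeBudget)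
open Summit.NavierStokesRegularity.NavierStokesRegularity.Cruxes.TypeIQuantSubcubicExp.QuietCollar
open scoped ENNReal NNReal

/-! ### F1. The consistency ceiling (item stmt-4050) and the degenerate stratum `M ≤ 0` -/

/-- Under item stmt-4050 every member of the class vanishes on the open past. [folklore] -/
theorem quietCore_eq_zero_of_typeIAncientLiouville (h : SymmetryModuliCount.TypeIAncientLiouville) {M : ℝ}
    {v : ℝ → EuclideanSpace ℝ (Fin 3) → EuclideanSpace ℝ (Fin 3)} (hv : IsTypeIAncientMild M v) :
    ∀ t < 0, ∀ x, v t x = 0 :=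
  h M v (isTypeIAncientMild_iff.1 hv)

/-- On the degenerate stratum `M ≤ 0` the class is the rest state, unconditionally. [folklore] -/
theorem quietCore_eq_zero_of_nonpos {M : ℝ} (hM : M ≤ 0)
    {v : ℝ → EuclideanSpace ℝ (Fin 3) → EuclideanSpace ℝ (Fin 3)} (hv : IsTypeIAncientMild M v) :
    ∀ t < 0, ∀ x, v t x = 0 := by
  intro t ht x
  have h1 : ‖v t x‖ ≤ M / Real.sqrt (-t) := hv.norm_le ht x
  have h2 : M / Real.sqrt (-t) ≤ 0 := div_nonpos_of_nonpos_of_nonneg hM (Real.sqrt_nonneg _)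
  exact norm_le_zero_iff.1 (h1.trans h2)

/-- **S3♭ `SubcriticalUpgrade M` (body verbatim) holds for every class all of whose members vanish**
(`c₀ = 1`, `s₁ = −1`). [folklore] -/
theorem subcriticalUpgrade_of_class_eq_zero {M : ℝ}
    (hz : ∀ v : ℝ → EuclideanSpace ℝ (Fin 3) → EuclideanSpace ℝ (Fin 3), IsTypeIAncientMild M v →
      ∀ t < 0, ∀ x, v t x = 0) :
    ∃ c₀ s₁ : ℝ, 0 < c₀ ∧ s₁ < 0 ∧
      ∀ v : ℝ → EuclideanSpace ℝ (Fin 3) → EuclideanSpace ℝ (Fin 3), IsTypeIAncientMild M v →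
        ∀ s ∈ Set.Ico s₁ 0,
          (∀ x ∈ Metric.ball (0 : EuclideanSpace ℝ (Fin 3)) 1, ‖v s x‖ ≤ c₀ / Real.sqrt (-s)) →
          ∀ t ∈ Set.Ico s 0, ∀ x ∈ Metric.ball (0 : EuclideanSpace ℝ (Fin 3)) (3 / 4),
            ‖v t x‖ ≤ 4 * c₀ * (-s) ^ (-(3 / 8 : ℝ)) * (-t) ^ (-(1 / 8 : ℝ)) := by
  refine ⟨1, -1, one_pos, by norm_num, fun v hv s hs _ t ht x _ => ?_⟩
  rw [hz v hv t ht.2 x, norm_zero]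
  have h1 : 0 ≤ (-s) ^ (-(3 / 8 : ℝ)) := Real.rpow_nonneg (by linarith [hs.2]) _
  have h2 : 0 ≤ (-t) ^ (-(1 / 8 : ℝ)) := Real.rpow_nonneg (by linarith [ht.2]) _
  exact mul_nonneg (mul_nonneg (mul_nonneg (by norm_num) (by norm_num)) h1) h2

/-- **Item stmt-4050 ⇒ S3♭ `StubSubcriticalUpgrade`** (body verbatim; CONDITIONAL, 4050 is open).
[folklore] -/
theorem subcriticalUpgradeStub_of_typeIAncientLiouville (h : SymmetryModuliCount.TypeIAncientLiouville) :
    ∀ M : ℝ, ∃ c₀ s₁ : ℝ, 0 < c₀ ∧ s₁ < 0 ∧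
      ∀ v : ℝ → EuclideanSpace ℝ (Fin 3) → EuclideanSpace ℝ (Fin 3), IsTypeIAncientMild M v →
        ∀ s ∈ Set.Ico s₁ 0,
          (∀ x ∈ Metric.ball (0 : EuclideanSpace ℝ (Fin 3)) 1, ‖v s x‖ ≤ c₀ / Real.sqrt (-s)) →
          ∀ t ∈ Set.Ico s 0, ∀ x ∈ Metric.ball (0 : EuclideanSpace ℝ (Fin 3)) (3 / 4),
            ‖v t x‖ ≤ 4 * c₀ * (-s) ^ (-(3 / 8 : ℝ)) * (-t) ^ (-(1 / 8 : ℝ)) :=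
  fun _ => subcriticalUpgrade_of_class_eq_zero fun _ hv => quietCore_eq_zero_of_typeIAncientLiouville h hv

/-- **S3♭ holds unconditionally on the stratum `M ≤ 0`** (body verbatim). [folklore] -/
theorem subcriticalUpgrade_of_nonpos {M : ℝ} (hM : M ≤ 0) :
    ∃ c₀ s₁ : ℝ, 0 < c₀ ∧ s₁ < 0 ∧
      ∀ v : ℝ → EuclideanSpace ℝ (Fin 3) → EuclideanSpace ℝ (Fin 3), IsTypeIAncientMild M v →
        ∀ s ∈ Set.Ico s₁ 0,
          (∀ x ∈ Metric.ball (0 : EuclideanSpace ℝ (Fin 3)) 1, ‖v s x‖ ≤ c₀ / Real.sqrt (-s)) →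
          ∀ t ∈ Set.Ico s 0, ∀ x ∈ Metric.ball (0 : EuclideanSpace ℝ (Fin 3)) (3 / 4),
            ‖v t x‖ ≤ 4 * c₀ * (-s) ^ (-(3 / 8 : ℝ)) * (-t) ^ (-(1 / 8 : ℝ)) :=
  subcriticalUpgrade_of_class_eq_zero fun _ hv => quietCore_eq_zero_of_nonpos hM hv

/-- **S4♭ `BudgetPass M B` with the budget hypothesis `CubeBudgetWith B v` DROPPED (a strengthening) holds
for every class all of whose members vanish** (`s₂ = −1`, `K = 0`). [folklore] -/
theorem budgetPass_of_class_eq_zero {M : ℝ}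
    (hz : ∀ v : ℝ → EuclideanSpace ℝ (Fin 3) → EuclideanSpace ℝ (Fin 3), IsTypeIAncientMild M v →
      ∀ t < 0, ∀ x, v t x = 0) :
    ∀ c₀ : ℝ, 0 < c₀ → ∃ s₂ K : ℝ, s₂ < 0 ∧ 0 ≤ K ∧
      ∀ v : ℝ → EuclideanSpace ℝ (Fin 3) → EuclideanSpace ℝ (Fin 3), IsTypeIAncientMild M v →
        ∀ s ∈ Set.Ico s₂ 0,
          (∀ t ∈ Set.Ico s 0, ∀ x ∈ Metric.ball (0 : EuclideanSpace ℝ (Fin 3)) (3 / 4),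
              ‖v t x‖ ≤ 4 * c₀ * (-s) ^ (-(3 / 8 : ℝ)) * (-t) ^ (-(1 / 8 : ℝ))) →
          ∀ t ∈ Set.Ico s 0, ∀ x ∈ Metric.ball (0 : EuclideanSpace ℝ (Fin 3)) (1 / 2),
            ‖v t x‖ ≤ K / Real.sqrt (-s) := by
  intro _ _
  refine ⟨-1, 0, by norm_num, le_rfl, fun v hv s _ _ t ht x _ => ?_⟩
  rw [hz v hv t ht.2 x, norm_zero, zero_div]

/-- **Item stmt-4050 ⇒ S4♭ `StubBudgetPass`, budget-free form** (CONDITIONAL): for every `M` (and hence every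
`B`, the dropped hypothesis only weakening the claim). [folklore] -/
theorem budgetPassStub_of_typeIAncientLiouville (h : SymmetryModuliCount.TypeIAncientLiouville) (M : ℝ) :
    ∀ c₀ : ℝ, 0 < c₀ → ∃ s₂ K : ℝ, s₂ < 0 ∧ 0 ≤ K ∧
      ∀ v : ℝ → EuclideanSpace ℝ (Fin 3) → EuclideanSpace ℝ (Fin 3), IsTypeIAncientMild M v →
        ∀ s ∈ Set.Ico s₂ 0,
          (∀ t ∈ Set.Ico s 0, ∀ x ∈ Metric.ball (0 : EuclideanSpace ℝ (Fin 3)) (3 / 4),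
              ‖v t x‖ ≤ 4 * c₀ * (-s) ^ (-(3 / 8 : ℝ)) * (-t) ^ (-(1 / 8 : ℝ))) →
          ∀ t ∈ Set.Ico s 0, ∀ x ∈ Metric.ball (0 : EuclideanSpace ℝ (Fin 3)) (1 / 2),
            ‖v t x‖ ≤ K / Real.sqrt (-s) :=
  budgetPass_of_class_eq_zero fun _ hv => quietCore_eq_zero_of_typeIAncientLiouville h hv

/-- **S4♭ (budget-free form) holds unconditionally on the stratum `M ≤ 0`.** [folklore] -/
theorem budgetPass_of_nonpos {M : ℝ} (hM : M ≤ 0) :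
    ∀ c₀ : ℝ, 0 < c₀ → ∃ s₂ K : ℝ, s₂ < 0 ∧ 0 ≤ K ∧
      ∀ v : ℝ → EuclideanSpace ℝ (Fin 3) → EuclideanSpace ℝ (Fin 3), IsTypeIAncientMild M v →
        ∀ s ∈ Set.Ico s₂ 0,
          (∀ t ∈ Set.Ico s 0, ∀ x ∈ Metric.ball (0 : EuclideanSpace ℝ (Fin 3)) (3 / 4),
              ‖v t x‖ ≤ 4 * c₀ * (-s) ^ (-(3 / 8 : ℝ)) * (-t) ^ (-(1 / 8 : ℝ))) →
          ∀ t ∈ Set.Ico s 0, ∀ x ∈ Metric.ball (0 : EuclideanSpace ℝ (Fin 3)) (1 / 2),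
            ‖v t x‖ ≤ K / Real.sqrt (-s) :=
  budgetPass_of_class_eq_zero fun _ hv => quietCore_eq_zero_of_nonpos hM hv

/-- **QC `QuietCore M B` with the budget hypothesis DROPPED (a strengthening) holds for every class all of whose
members vanish** (`c₀ = 1`, `s₁ = −1`, `K = 0`). [folklore] -/
theorem quietCore_of_class_eq_zero {M : ℝ}
    (hz : ∀ v : ℝ → EuclideanSpace ℝ (Fin 3) → EuclideanSpace ℝ (Fin 3), IsTypeIAncientMild M v →
      ∀ t < 0, ∀ x, v t x = 0) :
    ∃ c₀ s₁ K : ℝ, 0 < c₀ ∧ s₁ < 0 ∧ 0 ≤ K ∧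
      ∀ v : ℝ → EuclideanSpace ℝ (Fin 3) → EuclideanSpace ℝ (Fin 3), IsTypeIAncientMild M v →
        ∀ s ∈ Set.Ico s₁ 0,
          (∀ x ∈ Metric.ball (0 : EuclideanSpace ℝ (Fin 3)) 1, ‖v s x‖ ≤ c₀ / Real.sqrt (-s)) →
          ∀ t ∈ Set.Ico s 0, ∀ x ∈ Metric.ball (0 : EuclideanSpace ℝ (Fin 3)) (1 / 2),
            ‖v t x‖ ≤ K / Real.sqrt (-s) :=
  ⟨1, -1, 0, one_pos, by norm_num, le_rfl, fun v hv s _ _ t ht x _ => by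
    rw [hz v hv t ht.2 x, norm_zero, zero_div]⟩

/-- **Item stmt-4050 ⇒ QC `StubQuietCore`, budget-free form** (CONDITIONAL). [folklore] -/
theorem quietCoreStub_of_typeIAncientLiouville (h : SymmetryModuliCount.TypeIAncientLiouville) (M : ℝ) :
    ∃ c₀ s₁ K : ℝ, 0 < c₀ ∧ s₁ < 0 ∧ 0 ≤ K ∧
      ∀ v : ℝ → EuclideanSpace ℝ (Fin 3) → EuclideanSpace ℝ (Fin 3), IsTypeIAncientMild M v →
        ∀ s ∈ Set.Ico s₁ 0,
          (∀ x ∈ Metric.ball (0 : EuclideanSpace ℝ (Fin 3)) 1, ‖v s x‖ ≤ c₀ / Real.sqrt (-s)) →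
          ∀ t ∈ Set.Ico s 0, ∀ x ∈ Metric.ball (0 : EuclideanSpace ℝ (Fin 3)) (1 / 2),
            ‖v t x‖ ≤ K / Real.sqrt (-s) :=
  quietCore_of_class_eq_zero fun _ hv => quietCore_eq_zero_of_typeIAncientLiouville h hv

/-- **QC (budget-free form) holds unconditionally on the stratum `M ≤ 0`.** [folklore] -/
theorem quietCore_of_nonpos {M : ℝ} (hM : M ≤ 0) :
    ∃ c₀ s₁ K : ℝ, 0 < c₀ ∧ s₁ < 0 ∧ 0 ≤ K ∧
      ∀ v : ℝ → EuclideanSpace ℝ (Fin 3) → EuclideanSpace ℝ (Fin 3), IsTypeIAncientMild M v →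
        ∀ s ∈ Set.Ico s₁ 0,
          (∀ x ∈ Metric.ball (0 : EuclideanSpace ℝ (Fin 3)) 1, ‖v s x‖ ≤ c₀ / Real.sqrt (-s)) →
          ∀ t ∈ Set.Ico s 0, ∀ x ∈ Metric.ball (0 : EuclideanSpace ℝ (Fin 3)) (1 / 2),
            ‖v t x‖ ≤ K / Real.sqrt (-s) :=
  quietCore_of_class_eq_zero fun _ hv => quietCore_eq_zero_of_nonpos hM hv

/-- **Item stmt-4050 ⇒ no member of the class is singular anywhere** — the conclusion shared by Q3♭ (vacuously),
`LogCubeLiouville` and the rung `SmallBudgetLiouville`. [folklore] -/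
theorem not_singularAt_of_typeIAncientLiouville (h : SymmetryModuliCount.TypeIAncientLiouville) {M : ℝ}
    {v : ℝ → EuclideanSpace ℝ (Fin 3) → EuclideanSpace ℝ (Fin 3)} (hv : IsTypeIAncientMild M v)
    (a : EuclideanSpace ℝ (Fin 3)) : ¬ SingularAt v a :=
  not_singularAt_of_eq_zero (quietCore_eq_zero_of_typeIAncientLiouville h hv) a

/-- **Item stmt-4050 ⇒ Q3♭ `LocalRateFloorLogCube`** (by name; vacuously — no member is singular).
[folklore] -/
theorem localRateFloorLogCube_of_typeIAncientLiouville (h : SymmetryModuliCount.TypeIAncientLiouville) :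
    ∀ (M : ℝ) (v : ℝ → EuclideanSpace ℝ (Fin 3) → EuclideanSpace ℝ (Fin 3)),
      IsTypeIAncientMild M v → EnvelopeCubeBudget v → SingularAt v 0 → LocalRateFloor v :=
  fun _ _ hv _ hs => (not_singularAt_of_typeIAncientLiouville h hv 0 hs).elim

/-- **Item stmt-4050 ⇒ the rung `SmallBudgetLiouville M B₀` at EVERY level `B₀`** (body verbatim, the exposed
budget `CubeBudgetWith B v` written out): under the ceiling the first rung carries no information beyond
consistency. [folklore] -/
theorem smallBudgetLiouville_of_typeIAncientLiouville (h : SymmetryModuliCount.TypeIAncientLiouville)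
    (M B₀ : ℝ) :
    ∀ (B : ℝ) (v : ℝ → EuclideanSpace ℝ (Fin 3) → EuclideanSpace ℝ (Fin 3)), IsTypeIAncientMild M v →
      (0 ≤ B ∧ ∀ R : ℝ, 2 ≤ R → ∀ ε ∈ Set.Ioc (0 : ℝ) 1, ∃ b : ℝ, 0 ≤ b ∧
          b ^ 3 ≤ B * (1 + Real.log R + Real.log (1 / ε)) ∧
          ∀ s ∈ Set.Icc (-1 : ℝ) (-ε),
            eLpNorm ((Metric.ball (0 : EuclideanSpace ℝ (Fin 3)) R).indicator (v s)) 3 volume ≤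
              ENNReal.ofReal b) →
      B ≤ B₀ → ¬ SingularAt v 0 :=
  fun _ _ hv _ _ => not_singularAt_of_typeIAncientLiouville h hv 0

/-! ### F1′. Non-vacuity: the hypotheses of S3♭ / S4♭ / QC at the rest state -/

/-- The rest state is a class member (every `M ≥ 0`), carries the exposed budget `CubeBudgetWith 0` (body
verbatim, `b = 0`), is quiet on the unit core at EVERY `s < 0` at every level `c₀ ≥ 0`, and is subcritical in
the sense of S3♭'s conclusion / S4♭'s hypothesis: the hypotheses of S3♭, S4♭ and QC are jointly satisfiable.
[folklore] -/
theorem quietCore_hypotheses_restState {M : ℝ} (hM : 0 ≤ M) {c₀ : ℝ} (hc₀ : 0 ≤ c₀) :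
    IsTypeIAncientMild M (0 : ℝ → EuclideanSpace ℝ (Fin 3) → EuclideanSpace ℝ (Fin 3)) ∧
      (0 ≤ (0 : ℝ) ∧ ∀ R : ℝ, 2 ≤ R → ∀ ε ∈ Set.Ioc (0 : ℝ) 1, ∃ b : ℝ, 0 ≤ b ∧
          b ^ 3 ≤ 0 * (1 + Real.log R + Real.log (1 / ε)) ∧
          ∀ s ∈ Set.Icc (-1 : ℝ) (-ε),
            eLpNorm ((Metric.ball (0 : EuclideanSpace ℝ (Fin 3)) R).indicator
              ((0 : ℝ → EuclideanSpace ℝ (Fin 3) → EuclideanSpace ℝ (Fin 3)) s)) 3 volume ≤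
              ENNReal.ofReal b) ∧
      (∀ s < (0 : ℝ), ∀ x ∈ Metric.ball (0 : EuclideanSpace ℝ (Fin 3)) 1,
          ‖(0 : ℝ → EuclideanSpace ℝ (Fin 3) → EuclideanSpace ℝ (Fin 3)) s x‖ ≤ c₀ / Real.sqrt (-s)) ∧
      (∀ s < (0 : ℝ), ∀ t ∈ Set.Ico s 0, ∀ x ∈ Metric.ball (0 : EuclideanSpace ℝ (Fin 3)) (3 / 4),
          ‖(0 : ℝ → EuclideanSpace ℝ (Fin 3) → EuclideanSpace ℝ (Fin 3)) t x‖ ≤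
            4 * c₀ * (-s) ^ (-(3 / 8 : ℝ)) * (-t) ^ (-(1 / 8 : ℝ))) := by
  refine ⟨isTypeIAncientMild_zero hM,
    ⟨le_rfl, fun R _ ε _ => ⟨0, le_rfl, by simp, fun s _ => by simp⟩⟩, ?_, ?_⟩
  · intro s _ x _
    simp only [Pi.zero_apply, norm_zero]
    exact div_nonneg hc₀ (Real.sqrt_nonneg _)
  · intro s hs t ht x _
    simp only [Pi.zero_apply, norm_zero]
    have h1 : 0 ≤ (-s) ^ (-(3 / 8 : ℝ)) := Real.rpow_nonneg (by linarith) _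
    have h2 : 0 ≤ (-t) ^ (-(1 / 8 : ℝ)) := Real.rpow_nonneg (by linarith [ht.2]) _
    exact mul_nonneg (mul_nonneg (mul_nonneg (by norm_num) hc₀) h1) h2

/-! ### F2. Q2♭ is the converse edge with the apex value -/

/-- **`StubLogCubeExtractionFlat ↔ (LogCubeLiouville → TypeIQuantSubcubicExp)`** (Q2♭ body verbatim on the
left; pure logic). [folklore] -/
theorem stubLogCubeExtractionFlat_iff_converse :
    (¬ QuarterLogPincer.TypeIQuantSubcubicExp →
        ∃ (M : ℝ) (v : ℝ → EuclideanSpace ℝ (Fin 3) → EuclideanSpace ℝ (Fin 3)),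
          IsTypeIAncientMild M v ∧ EnvelopeCubeBudget v ∧ SingularAt v 0) ↔
      (LogCubeLiouville → QuarterLogPincer.TypeIQuantSubcubicExp) := by
  constructor
  · intro h hL
    by_contra hn
    obtain ⟨M, v, hv, hB, hs⟩ := h hn
    exact hL M v hv hB hs
  · intro h hn
    by_contra hne
    push Not at hne
    exact hn (h fun M v hv hB hs => hne M v hv hB hs)

/-- **`¬ LogCubeLiouville → StubLogCubeExtractionFlat`**: in the wall world Q2♭ holds outright. [folklore] -/
theorem stubLogCubeExtractionFlat_of_not_logCubeLiouville (hL : ¬ LogCubeLiouville) :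
    ¬ QuarterLogPincer.TypeIQuantSubcubicExp →
      ∃ (M : ℝ) (v : ℝ → EuclideanSpace ℝ (Fin 3) → EuclideanSpace ℝ (Fin 3)),
        IsTypeIAncientMild M v ∧ EnvelopeCubeBudget v ∧ SingularAt v 0 := by
  intro _
  by_contra hne
  push Not at hne
  exact hL fun M v hv hB hs => hne M v hv hB hs

/-- **Under item stmt-4050, `StubLogCubeExtractionFlat ↔ TypeIQuantSubcubicExp`**: in the Liouville world the
converse stub carries the whole crux. [folklore] -/
theorem stubLogCubeExtractionFlat_iff_crux_of_typeIAncientLiouville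
    (h : SymmetryModuliCount.TypeIAncientLiouville) :
    (¬ QuarterLogPincer.TypeIQuantSubcubicExp →
        ∃ (M : ℝ) (v : ℝ → EuclideanSpace ℝ (Fin 3) → EuclideanSpace ℝ (Fin 3)),
          IsTypeIAncientMild M v ∧ EnvelopeCubeBudget v ∧ SingularAt v 0) ↔
      QuarterLogPincer.TypeIQuantSubcubicExp :=
  stubLogCubeExtractionFlat_iff_converse.trans
    ⟨fun hc => hc (logCubeLiouville_of_typeIAncientLiouville' h), fun hc _ => hc⟩

/-! ### F3. Wall placement of the de-flickered loop -/

/-- **INSTRUMENT ROW AS THEOREM.** Any Type-I (rotated-)DSS profile (every ratio `c > 1`, every isometry `R`)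
gives Q2♭ outright, refutes the crux (landed T1 edge) and refutes the loop value `LogCubeLiouville`; LOOP♭'s
identification `TypeIQuantSubcubicExp ↔ LogCubeLiouville` then holds as `False ↔ False`, with no stub.
[folklore] -/
theorem quietCore_loop_of_isTypeIDSSProfile {c : ℝ}
    {R : EuclideanSpace ℝ (Fin 3) ≃ₗᵢ[ℝ] EuclideanSpace ℝ (Fin 3)}
    {u : ℝ → EuclideanSpace ℝ (Fin 3) → EuclideanSpace ℝ (Fin 3)} (h : IsTypeIDSSProfile c R u) :
    (¬ QuarterLogPincer.TypeIQuantSubcubicExp →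
        ∃ (M : ℝ) (v : ℝ → EuclideanSpace ℝ (Fin 3) → EuclideanSpace ℝ (Fin 3)),
          IsTypeIAncientMild M v ∧ EnvelopeCubeBudget v ∧ SingularAt v 0) ∧
      ¬ QuarterLogPincer.TypeIQuantSubcubicExp ∧ ¬ LogCubeLiouville ∧
      (QuarterLogPincer.TypeIQuantSubcubicExp ↔ LogCubeLiouville) :=
  have hL : ¬ LogCubeLiouville := (not_logCube_values_of_isTypeIDSSProfile h).2
  have hc : ¬ QuarterLogPincer.TypeIQuantSubcubicExp :=
    TruncationEdge.not_typeIQuantSubcubicExp_of_isTypeIDSSProfile' h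
  ⟨stubLogCubeExtractionFlat_of_not_logCubeLiouville hL, hc, hL,
    ⟨fun x => (hc x).elim, fun x => (hL x).elim⟩⟩

/-- `¬ FiniteDissipationLiouville` (22144) gives Q2♭ outright and refutes the loop value. [folklore] -/
theorem stubLogCubeExtractionFlat_of_not_finiteDissipationLiouville
    (h : ¬ LerayQuarterDissipation.FiniteDissipationLiouville) :
    (¬ QuarterLogPincer.TypeIQuantSubcubicExp →
        ∃ (M : ℝ) (v : ℝ → EuclideanSpace ℝ (Fin 3) → EuclideanSpace ℝ (Fin 3)),
          IsTypeIAncientMild M v ∧ EnvelopeCubeBudget v ∧ SingularAt v 0) ∧ ¬ LogCubeLiouville :=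
  ⟨stubLogCubeExtractionFlat_of_not_logCubeLiouville (not_logCube_values_of_not_finiteDissipationLiouville h).2,
    (not_logCube_values_of_not_finiteDissipationLiouville h).2⟩

/-- `¬ AsymmetricFlickerLiouville` (24453) gives Q2♭ outright and refutes the loop value. [folklore] -/
theorem stubLogCubeExtractionFlat_of_not_asymmetricFlickerLiouville
    (h : ¬ CalmSliceGate.AsymmetricFlickerLiouville) :
    (¬ QuarterLogPincer.TypeIQuantSubcubicExp →
        ∃ (M : ℝ) (v : ℝ → EuclideanSpace ℝ (Fin 3) → EuclideanSpace ℝ (Fin 3)),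
          IsTypeIAncientMild M v ∧ EnvelopeCubeBudget v ∧ SingularAt v 0) ∧ ¬ LogCubeLiouville :=
  ⟨stubLogCubeExtractionFlat_of_not_logCubeLiouville (not_logCube_values_of_not_asymmetricFlickerLiouville h).2,
    (not_logCube_values_of_not_asymmetricFlickerLiouville h).2⟩

end Summit.NavierStokesRegularity.NavierStokesRegularity.Theorems.TypeIQuantSubcubicExp.Negative
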